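import Summits.AtomisticToContinuum.Crystallization.Theorems.FrustratedLawDichotomyStrainedPatchHomEntryLeafHTA2QCellBXA2
import Summits.AtomisticToContinuum.Crystallization.Theorems.FrustratedLawDichotomyStrainedPatchHomEntryLeafHTA2QExists

/-!
# ★★★ THE SIX-COARSE MIXED CELL END TO END with a TWO-FACT inner tree: `entryLeafOKHT4A2QQDCR muRec qX90c pBXA2 QBX GnBX JB065 tBX16 cB065 wBXA = true`
# (27623 `(H) HomFloor (1/625)`, hcp half; hand-1 g35 FINDING §3e — the multi-fact inner-tree pattern every production cell above the kernel's memory cap needs)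

decomp-a2c hand-1 g35.  KERNEL: `treeBX_lo` / `treeBX_hi` — the 8-leaf half-tree `tBXh` on the lower / upper `ζ_x`-half of the confined box `htWr pBXA2 cB065 wBXA`, stated on
EXACTLY the child boxes `…HomCertTree.treeOK` produces (`Function.update` at `Sum.inr 0`), so that ★ `treeOK_split_rfl` glues them with `rfl` box identities and one
cheap parity `decide`; ★★★ `entryLeafOKHT4A2QQDCR_BXA2` (assembly with `…CellBXA2.htCertSideA2Q_BXA2`) and ★ `okE_BX` (one-leaf ∃-tree of the production verdict).
Per-cell cost ≈ certificate 470 s + inner 2 × ≈ 100 s.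

Bookkeeping lemma + kernel facts + assembly; 0 sorry; standard axioms; no definitions.  `--supports stmt-AtomisticToContinuum-27623`.
-/

namespace Summit.AtomisticToContinuum.Crystallization.Theorems.FrustratedLawDichotomyStrainedPatchHomEntryLeafHT

open Literature.Analysis.ValidatedNumerics.Numerics
open Summit.AtomisticToContinuum.Crystallization.Theorems.FrustratedLawDichotomyStrainedPatchHomCertTree (CertTree treeOK)
open Summit.AtomisticToContinuum.Crystallization.Theorems.FrustratedLawDichotomyStrainedPatchHomEntryTable (muRec)
open Summit.AtomisticToContinuum.Crystallization.Theorems.FrustratedLawDichotomyStrainedPatchHomEntryFitHcpCentred (entryLeafOKHQDCR)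
open Summit.AtomisticToContinuum.Crystallization.Theorems.FrustratedLawDichotomyStrainedPatchHomSlopeLJ
open Summit.AtomisticToContinuum.Crystallization.Theorems.FrustratedLawDichotomyStrainedPatchHomSlopeLJAffine
open Summit.AtomisticToContinuum.Crystallization.Theorems.FrustratedLawDichotomyStrainedPatchHomSlopeLJAffine2Kit

/-- A split node from its two children stated on the child boxes `treeOK` itself produces. [formal bookkeeping] -/
theorem treeOK_split_rfl {κ : Type} [DecidableEq κ] {v : (κ → ℤ) → (κ → ℤ) → Bool} {l r : CertTree κ} {c w : κ → ℤ} (k : κ) (hev : w k % 2 = 0)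
    (hl : treeOK v l (Function.update c k (c k - w k / 2)) (Function.update w k (w k / 2)) = true)
    (hr : treeOK v r (Function.update c k (c k + w k / 2)) (Function.update w k (w k / 2)) = true) :
    treeOK v (.split k l r) c w = true := by
  simp only [treeOK, Bool.and_eq_true, decide_eq_true_eq]
  exact ⟨⟨hev, hl⟩, hr⟩

set_option maxRecDepth 100000 in
set_option maxHeartbeats 4000000 in
/-- ★ KERNEL: the half-tree on the LOWER `ζ_x`-half of the confined box (8 leaves). -/
theorem treeBX_lo : treeOK (hullInner (entryLeafOKHQDCR muRec qX90c) JB065 cB065) tBXh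
    (Function.update cB065 (Sum.inr 0) (cB065 (Sum.inr 0) - htWr pBXA2 cB065 wBXA (Sum.inr 0) / 2))
    (Function.update (htWr pBXA2 cB065 wBXA) (Sum.inr 0) (htWr pBXA2 cB065 wBXA (Sum.inr 0) / 2)) = true := by
  decide +kernel

set_option maxRecDepth 100000 in
set_option maxHeartbeats 4000000 in
/-- ★ KERNEL: the half-tree on the UPPER `ζ_x`-half of the confined box (8 leaves). -/
theorem treeBX_hi : treeOK (hullInner (entryLeafOKHQDCR muRec qX90c) JB065 cB065) tBXh
    (Function.update cB065 (Sum.inr 0) (cB065 (Sum.inr 0) + htWr pBXA2 cB065 wBXA (Sum.inr 0) / 2))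
    (Function.update (htWr pBXA2 cB065 wBXA) (Sum.inr 0) (htWr pBXA2 cB065 wBXA (Sum.inr 0) / 2)) = true := by
  decide +kernel

/-- KERNEL (cheap): the `ζ_x` half-width of the confined box is even. -/
theorem htWr_BX_even : htWr pBXA2 cB065 wBXA (Sum.inr 0) % 2 = 0 := by
  decide +kernel

/-- ★ The 16-leaf inner tree closes the confined box of the six-coarse cell (two kernel facts glued). [assembly] -/
theorem treeA2Q_BX : treeOK (hullInner (entryLeafOKHQDCR muRec qX90c) JB065 cB065) tBX16 cB065 (htWr pBXA2 cB065 wBXA) = true :=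
  treeOK_split_rfl (Sum.inr 0) htWr_BX_even treeBX_lo treeBX_hi

/-- ★★★ **THE SIX-COARSE MIXED CELL CLOSES END TO END** (`2⁻⁹` on six of nine entry axes; certificate as is, `t = 0.0153`). [assembly] -/
theorem entryLeafOKHT4A2QQDCR_BXA2 : entryLeafOKHT4A2QQDCR muRec qX90c pBXA2 QBX GnBX JB065 tBX16 cB065 wBXA = true := by
  have h1 := htCertSideA2Q_BXA2
  have h2 := treeA2Q_BX
  unfold entryLeafOKHT4A2QQDCR entryLeafOKHT4A2Q
  rw [h1, h2]
  rfl

/-- ★ … hence the six-coarse cell is a one-leaf ∃-tree of the production verdict `entryLeafOKHT4A2QQDCRE muRec`. [formal bookkeeping] -/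
theorem okE_BX : ∃ t : CertTree ((Fin 3 × Fin 3) ⊕ Fin 3), treeOK (entryLeafOKHT4A2QQDCRE muRec) t cB065 wBXA = true :=
  exists_tree_HT4A2QQDCRE_of_cert entryLeafOKHT4A2QQDCR_BXA2

end Summit.AtomisticToContinuum.Crystallization.Theorems.FrustratedLawDichotomyStrainedPatchHomEntryLeafHT
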